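import Literature.AlgebraicGeometry.Motives.GaloisEquivariancePushforward
import Literature.AlgebraicGeometry.Motives.FrobeniusDominatedVarieties
import Literature.RepresentationTheory.Semisimple.CharpolySubquotient
import HarnessLib

/-!
# The transfer `x ↦ f₊ (x ∪ ζ)` is Galois equivariant; `Pᵢ(V) = Pᵢ(U) · det(1 - T F | Ker)`

Let `E : GaloisWeilCohomology k K χ` be a Weil cohomology theory with Galois action and let the
smooth projective `U` (`dim U = M`) be dominated by `V` (`dim V = N = M + r`) through `f : V ⟶ U`
and a rational algebraic class `ζ ∈ Aʳ(V)_ℚ` with `f₊ ζ ≠ 0` (Kleiman 1968 Prop. 1.2.4; Kahn 2020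
Lemma 6.30 (2)), so that `f₊ ζ = q · 1`, `q ≠ 0`, and `f₊ (f* x ∪ ζ) = q x`. The degree-preserving
transfer
`g = f₊ (· ∪ ζ) : Hⁱ(V) → Hⁱ(U)`
(the correspondence `ᵗΓ_f ∘ [ζ]` of degree `0`) satisfies:

* **`g` is `Γ_k`-equivariant** (`ρ_pushforward_cup`): `f₊` is equivariant up to `χ^{M-N}`
  (`pushforward_ρ`, Kahn 2020 §3.5.1), `ζ` is invariant in `H^{2r}(V)(r)` (`cycleClass_ρ`), and the
  twists cancel (`r + M - N = 0`); hence `Ker g ⊆ Hⁱ(V)` is a subrepresentation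
  (`frob`/`ρ`-stable, `ρ_mem_ker_pushforward_cup`) — the Galois-stable complement of `f* Hⁱ(U)` in
  `Hⁱ(V) = f* Hⁱ(U) ⊕ Ker g` — and `g` is onto (`pushforward_cup_surjective`);
* over a finite field, **`det(T - F | Hⁱ(V)) = det(T - F | Ker g) · det(T - F | Hⁱ(U))`**
  (`charpoly_frobAction_eq_restrict_mul`: the exact sequence `0 → Ker g → Hⁱ(V) → Hⁱ(U) → 0` is
  `F`-equivariant; Bourbaki A VIII § 20 n° 6), refining the divisibility `Pᵢ(U) ∣ Pᵢ(V)` of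
  `FrobeniusDominatedVarieties` to **`Pᵢ(V, T) = det(1 - T F | Ker g) · Pᵢ(U, T)`**
  (`frobCharPoly_eq_reverse_charpoly_restrict_mul`; Deligne 1974 (1.5.4));
* the equidimensional case (`N = M`, `f` of non-zero degree, `ζ = 1`, `g = f₊`): `F ∘ f₊ = f₊ ∘ F`
  (`frobAction_comp_pushforward_of_dim_eq`) and
  `det(T - F | Hⁱ(V)) = det(T - F | Ker f₊) · det(T - F | Hⁱ(U))`.

Theorems only (no definition, no named fact, no instance).

## References

* [Kahn2020] B. Kahn, *Zeta and L-functions of varieties and motives*, LMS Lecture Note Ser. 462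
  (2020), §3.5.1, §6.9 Lemma 6.30 (2).
* [Kleiman1968AlgebraicCycles] S. Kleiman, *Algebraic cycles and the Weil conjectures*, in: Dix
  exposés sur la cohomologie des schémas (1968), §1.2 Prop. 1.2.4, §1.3.
* [Deligne1974] P. Deligne, *La conjecture de Weil. I*, Publ. Math. IHÉS 43 (1974), (1.5), (1.5.4).
* [BourbakiAlgebreVIII2012] N. Bourbaki, *Algèbre*, Ch. VIII (2012), § 20 n° 6 (p. 377).
* [Tate1994] J. Tate, *Conjectures on algebraic cycles in ℓ-adic cohomology* (1994), §1.
-/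

universe u v

open CategoryTheory AlgebraicGeometry Polynomial

noncomputable section

namespace Literature.AlgebraicGeometry.Motives

namespace GaloisWeilCohomology

variable {k : Type u} [Field k] {K : Type v} [Field K] [CharZero K]
  {χ : Field.absoluteGaloisGroup k →* Kˣ} (E : GaloisWeilCohomology k K χ)
variable {N M r : ℕ} {V U : SchemeOver k}

/-! ## `x ↦ f₊ (x ∪ ζ)` is Galois equivariant -/

/-- **`σ f₊ (x ∪ ζ) = f₊ (σ x ∪ ζ)`** for `ζ ∈ Aʳ(V)_ℚ`, `dim V = dim U + r`, `σ ∈ Γ_k`: the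
transfer `f₊ (· ∪ ζ) : Hⁱ(V) → Hⁱ(U)` is Galois equivariant (`f₊ ∘ σ = χ(σ)^{M-N} σ ∘ f₊`,
Kahn 2020 §3.5.1 / Tate 1994 §1; `χ(σ)ʳ σ ζ = ζ`, `cycleClass_ρ`; `σ (x ∪ ζ) = σ x ∪ σ ζ`).
Degrees: `i + i' = 2M`, `i + 2r + i' = 2N`. [cite: Kahn2020, §3.5.1] [cite: Tate1994, §1] -/
theorem ρ_pushforward_cup (hV : IsSmoothProjective N V) (hU : IsSmoothProjective M U) (f : V ⟶ U)
    (hr : M + r = N) {ζ : E.obj V (2 * r)} (hζ : ζ ∈ E.ratAlgebraicClasses V r) {i i' : ℕ}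
    (hi : i + i' = 2 * M) (he' : i + 2 * r + i' = 2 * N) (σ : Field.absoluteGaloisGroup k)
    (x : E.obj V i) :
    E.ρ U i σ (E.pushforward (N := N) hU f he' hi (E.cup rfl x ζ)) =
      E.pushforward (N := N) hU f he' hi (E.cup rfl (E.ρ V i σ x) ζ) := by
  have hχ : (χ σ : K) ≠ 0 := Units.ne_zero _
  have hζσ : ((χ σ : K) ^ (r : ℤ)) • E.ρ V (2 * r) σ ζ = ζ := by
    have h := E.mem_invariants_of_mem_ratAlgebraicClasses hV hζ σ
    rwa [E.ρTwist_apply] at h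
  conv_rhs => rw [← hζσ]
  rw [map_smul, map_smul, ← E.cup_ρ hV rfl σ x ζ, E.pushforward_ρ hV hU f he' hi σ, smul_smul,
    ← zpow_add₀ hχ, show (r : ℤ) + ((M : ℤ) - N) = 0 by omega, zpow_zero, one_smul]

/-- `σ ∘ f₊ (· ∪ ζ) = f₊ (· ∪ ζ) ∘ σ` as linear maps `Hⁱ(V) → Hⁱ(U)` (`ρ_pushforward_cup`).
[cite: Kahn2020, §3.5.1] [cite: Tate1994, §1] -/
theorem ρ_comp_pushforward_cup (hV : IsSmoothProjective N V) (hU : IsSmoothProjective M U)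
    (f : V ⟶ U) (hr : M + r = N) {ζ : E.obj V (2 * r)} (hζ : ζ ∈ E.ratAlgebraicClasses V r)
    {i i' : ℕ} (hi : i + i' = 2 * M) (he' : i + 2 * r + i' = 2 * N)
    (σ : Field.absoluteGaloisGroup k) :
    E.ρ U i σ ∘ₗ (E.pushforward (N := N) hU f he' hi ∘ₗ (E.cup (rfl : i + 2 * r = i + 2 * r)).flip ζ) =
      (E.pushforward (N := N) hU f he' hi ∘ₗ (E.cup (rfl : i + 2 * r = i + 2 * r)).flip ζ) ∘ₗ
        E.ρ V i σ :=
  LinearMap.ext fun x ↦ by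
    simp only [LinearMap.comp_apply, LinearMap.flip_apply]
    exact E.ρ_pushforward_cup hV hU f hr hζ hi he' σ x

/-- **`Ker f₊ (· ∪ ζ) ⊆ Hⁱ(V)` is a subrepresentation**: it is stable under every `σ ∈ Γ_k`
(`ρ_pushforward_cup`) — the Galois-stable complement of `f* Hⁱ(U)` in `Hⁱ(V)`. [cite: Tate1994, §1] -/
theorem ρ_mem_ker_pushforward_cup (hV : IsSmoothProjective N V) (hU : IsSmoothProjective M U)
    (f : V ⟶ U) (hr : M + r = N) {ζ : E.obj V (2 * r)} (hζ : ζ ∈ E.ratAlgebraicClasses V r)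
    {i i' : ℕ} (hi : i + i' = 2 * M) (he' : i + 2 * r + i' = 2 * N)
    (σ : Field.absoluteGaloisGroup k) {x : E.obj V i}
    (hx : x ∈ LinearMap.ker
      (E.pushforward (N := N) hU f he' hi ∘ₗ (E.cup (rfl : i + 2 * r = i + 2 * r)).flip ζ)) :
    E.ρ V i σ x ∈ LinearMap.ker
      (E.pushforward (N := N) hU f he' hi ∘ₗ (E.cup (rfl : i + 2 * r = i + 2 * r)).flip ζ) := by
  rw [LinearMap.mem_ker, LinearMap.comp_apply, LinearMap.flip_apply] at hx ⊢
  rw [← E.ρ_pushforward_cup hV hU f hr hζ hi he' σ x, hx, map_zero]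

/-- **`f* Hⁱ(U) ⊆ Hⁱ(V)` is a subrepresentation** (`σ f* y = f* σ y`, axiom `pullback_ρ`).
[cite: Tate1994, §1] -/
theorem ρ_mem_range_pullback (hV : IsSmoothProjective N V) (hU : IsSmoothProjective M U)
    (f : V ⟶ U) {i : ℕ} (σ : Field.absoluteGaloisGroup k) {x : E.obj V i}
    (hx : x ∈ LinearMap.range (E.pullback f i)) : E.ρ V i σ x ∈ LinearMap.range (E.pullback f i) := by
  obtain ⟨y, rfl⟩ := hx
  exact ⟨E.ρ U i σ y, by
    rw [← LinearMap.comp_apply, ← E.pullback_ρ hV hU f i σ, LinearMap.comp_apply]⟩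

/-- **`x ↦ f₊ (x ∪ ζ) : Hⁱ(V) → Hⁱ(U)` is surjective for `U` dominated by `V`**
(`f₊ (f* y ∪ ζ) = q y`, `q ≠ 0`; projection formula, Kahn 2020 §3.5.1).
[cite: Kahn2020, §3.5.1 and §6.9 Lemma 6.30 (2)] -/
theorem pushforward_cup_surjective (hV : IsSmoothProjective N V) (hU : IsSmoothProjective M U)
    (f : V ⟶ U) {ζ : E.obj V (2 * r)} (hζ : ζ ∈ E.ratAlgebraicClasses V r)
    {he : 2 * r + 2 * M = 2 * N} {hd : 0 + 2 * M = 2 * M}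
    (hne : E.pushforward (N := N) hU f he hd ζ ≠ 0) {i i' : ℕ} (hi : i + i' = 2 * M)
    (he' : i + 2 * r + i' = 2 * N) :
    Function.Surjective
      (E.pushforward (N := N) hU f he' hi ∘ₗ (E.cup (rfl : i + 2 * r = i + 2 * r)).flip ζ) := by
  obtain ⟨q, hq⟩ := E.exists_pushforward_eq_ratCast_smul_one hV hU f hζ he hd
  have hq0 : (q : K) ≠ 0 := fun h ↦ hne (by rw [hq, h, zero_smul])
  intro y
  refine ⟨E.pullback f i ((q : K)⁻¹ • y), ?_⟩
  rw [LinearMap.comp_apply, LinearMap.flip_apply, E.pushforward_pullback_cup_eq_smul hV hU f hq hi he',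
    smul_smul, mul_inv_cancel₀ hq0, one_smul]

/-! ## Frobenius: `det(T - F | Hⁱ(V)) = det(T - F | Ker) · det(T - F | Hⁱ(U))` -/

section Frobenius

variable [Finite k]

/-- **`F f₊ (x ∪ ζ) = f₊ (F x ∪ ζ)`** for the geometric Frobenius (`ρ_pushforward_cup` at
`σ = geomFrob k`). [cite: Deligne1974, (1.5)] [cite: Kahn2020, §3.5.1] -/
theorem frobAction_pushforward_cup (hV : IsSmoothProjective N V) (hU : IsSmoothProjective M U)
    (f : V ⟶ U) (hr : M + r = N) {ζ : E.obj V (2 * r)} (hζ : ζ ∈ E.ratAlgebraicClasses V r)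
    {i i' : ℕ} (hi : i + i' = 2 * M) (he' : i + 2 * r + i' = 2 * N) (x : E.obj V i) :
    E.frobAction U i (E.pushforward (N := N) hU f he' hi (E.cup rfl x ζ)) =
      E.pushforward (N := N) hU f he' hi (E.cup rfl (E.frobAction V i x) ζ) := by
  rw [E.frobAction_def, E.frobAction_def]
  exact E.ρ_pushforward_cup hV hU f hr hζ hi he' (geomFrob k) x

/-- `Ker f₊ (· ∪ ζ)` is `F`-stable. [cite: Deligne1974, (1.5)] -/
theorem frobAction_mem_ker_pushforward_cup (hV : IsSmoothProjective N V)
    (hU : IsSmoothProjective M U) (f : V ⟶ U) (hr : M + r = N) {ζ : E.obj V (2 * r)}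
    (hζ : ζ ∈ E.ratAlgebraicClasses V r) {i i' : ℕ} (hi : i + i' = 2 * M)
    (he' : i + 2 * r + i' = 2 * N) {x : E.obj V i}
    (hx : x ∈ LinearMap.ker
      (E.pushforward (N := N) hU f he' hi ∘ₗ (E.cup (rfl : i + 2 * r = i + 2 * r)).flip ζ)) :
    E.frobAction V i x ∈ LinearMap.ker
      (E.pushforward (N := N) hU f he' hi ∘ₗ (E.cup (rfl : i + 2 * r = i + 2 * r)).flip ζ) := by
  rw [E.frobAction_def]
  exact E.ρ_mem_ker_pushforward_cup hV hU f hr hζ hi he' (geomFrob k) hx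

/-- **`det(T - F | Hⁱ(V)) = det(T - F | Ker f₊(· ∪ ζ)) · det(T - F | Hⁱ(U))` for `U` dominated by
`V`**: the sequence `0 → Ker g → Hⁱ(V) —g→ Hⁱ(U) → 0`, `g = f₊ (· ∪ ζ)`, is exact, `F`-equivariant
(`frobAction_pushforward_cup`) and `g` is onto (`pushforward_cup_surjective`); the characteristic
polynomial is multiplicative along equivariant exact sequences (Bourbaki A VIII § 20 n° 6). The
`F`-stability of the kernel is the hypothesis `hst` (supplied by `frobAction_mem_ker_pushforward_cup`).
[cite: BourbakiAlgebreVIII2012, VIII § 20 n° 6 (p. 377)] [cite: Deligne1974, (1.5.4)] -/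
theorem charpoly_frobAction_eq_restrict_mul (hV : IsSmoothProjective N V)
    (hU : IsSmoothProjective M U) (f : V ⟶ U) {ζ : E.obj V (2 * r)}
    (hζ : ζ ∈ E.ratAlgebraicClasses V r) {he : 2 * r + 2 * M = 2 * N} {hd : 0 + 2 * M = 2 * M}
    (hne : E.pushforward (N := N) hU f he hd ζ ≠ 0) {i i' : ℕ} (hi : i + i' = 2 * M)
    (he' : i + 2 * r + i' = 2 * N)
    (hst : ∀ x ∈ LinearMap.ker
        (E.pushforward (N := N) hU f he' hi ∘ₗ (E.cup (rfl : i + 2 * r = i + 2 * r)).flip ζ),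
      E.frobAction V i x ∈ LinearMap.ker
        (E.pushforward (N := N) hU f he' hi ∘ₗ (E.cup (rfl : i + 2 * r = i + 2 * r)).flip ζ)) :
    (haveI := E.finite_obj hV i; (E.frobAction V i).charpoly) =
      (haveI := E.finite_obj hV i; ((E.frobAction V i).restrict hst).charpoly) *
        (haveI := E.finite_obj hU i; (E.frobAction U i).charpoly) := by
  haveI := E.finite_obj hV i
  haveI := E.finite_obj hU i
  set g := E.pushforward (N := N) hU f he' hi ∘ₗ (E.cup (rfl : i + 2 * r = i + 2 * r)).flip ζ
    with hg
  refine Literature.RepresentationTheory.Semisimple.LinearMap.charpoly_eq_mul_of_exact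
    (E.frobAction V i) (LinearMap.ker g).subtype g (LinearMap.ker g).injective_subtype (E.pushforward_cup_surjective hV hU f hζ hne hi he')
    (Submodule.range_subtype _) ((E.frobAction V i).restrict hst) (E.frobAction U i)
    (LinearMap.ext fun x ↦ rfl) (LinearMap.ext fun x ↦ ?_)
  simp only [hg, LinearMap.comp_apply, LinearMap.flip_apply]
  exact (E.frobAction_pushforward_cup hV hU f (by omega) hζ hi he' x).symm

/-- **`Pᵢ(V, T) = det(1 - T F | Ker f₊(· ∪ ζ)) · Pᵢ(U, T)` for `U` dominated by `V`** (`Pᵢ =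
det(1 - T·F | Hⁱ)`, `E.frobCharPoly`; reversal of `charpoly_frobAction_eq_restrict_mul`): the
explicit cofactor of the divisibility `Pᵢ(U) ∣ Pᵢ(V)` (`frobCharPoly_dvd_of_pushforward_ne_zero`).
[cite: Deligne1974, (1.5.4)] [cite: BourbakiAlgebreVIII2012, VIII § 20 n° 6 (p. 377)] -/
theorem frobCharPoly_eq_reverse_charpoly_restrict_mul (hV : IsSmoothProjective N V)
    (hU : IsSmoothProjective M U) (f : V ⟶ U) {ζ : E.obj V (2 * r)}
    (hζ : ζ ∈ E.ratAlgebraicClasses V r) {he : 2 * r + 2 * M = 2 * N} {hd : 0 + 2 * M = 2 * M}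
    (hne : E.pushforward (N := N) hU f he hd ζ ≠ 0) {i i' : ℕ} (hi : i + i' = 2 * M)
    (he' : i + 2 * r + i' = 2 * N)
    (hst : ∀ x ∈ LinearMap.ker
        (E.pushforward (N := N) hU f he' hi ∘ₗ (E.cup (rfl : i + 2 * r = i + 2 * r)).flip ζ),
      E.frobAction V i x ∈ LinearMap.ker
        (E.pushforward (N := N) hU f he' hi ∘ₗ (E.cup (rfl : i + 2 * r = i + 2 * r)).flip ζ)) :
    E.frobCharPoly V i =
      (haveI := E.finite_obj hV i; ((E.frobAction V i).restrict hst).charpoly.reverse) *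
        E.frobCharPoly U i := by
  rw [E.frobCharPoly_eq hV i, E.frobCharPoly_eq hU i,
    E.charpoly_frobAction_eq_restrict_mul hV hU f hζ hne hi he' hst, Polynomial.reverse_mul_of_domain]

/-! ## The equidimensional case: `g = f₊` -/

/-- **`F ∘ f₊ = f₊ ∘ F` for `f : V ⟶ U` between varieties of the same dimension** (the twist
`χ(F)^{N-M}` of `frobAction_comp_pushforward` is trivial). [cite: Deligne1974, (1.5)] [cite: Kahn2020, §3.5.1] -/
theorem frobAction_comp_pushforward_of_dim_eq (hV : IsSmoothProjective N V)
    (hU : IsSmoothProjective N U) (f : V ⟶ U) {e d c : ℕ} (he : e + c = 2 * N) (hd : d + c = 2 * N) :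
    E.frobAction U d ∘ₗ E.pushforward (N := N) hU f he hd =
      E.pushforward (N := N) hU f he hd ∘ₗ E.frobAction V e := by
  rw [E.frobAction_comp_pushforward hV hU f he hd, sub_self, zpow_zero, one_smul]

/-- `Ker f₊ ⊆ Hⁱ(V)` is `F`-stable for `f : V ⟶ U` equidimensional. [cite: Deligne1974, (1.5)] -/
theorem frobAction_mem_ker_pushforward (hV : IsSmoothProjective N V) (hU : IsSmoothProjective N U)
    (f : V ⟶ U) {i i' : ℕ} (hi : i + i' = 2 * N) {x : E.obj V i}
    (hx : x ∈ LinearMap.ker (E.pushforward (N := N) hU f hi hi)) :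
    E.frobAction V i x ∈ LinearMap.ker (E.pushforward (N := N) hU f hi hi) := by
  rw [LinearMap.mem_ker] at hx ⊢
  rw [← LinearMap.comp_apply, ← E.frobAction_comp_pushforward_of_dim_eq hV hU f hi hi,
    LinearMap.comp_apply, hx, map_zero]

/-- **`det(T - F | Hⁱ(V)) = det(T - F | Ker f₊) · det(T - F | Hⁱ(U))` for `f : V ⟶ U` of non-zero
degree** (`V`, `U` of the same dimension `N`, `f* ≠ 0` on `H²ᴺ(U)`): `0 → Ker f₊ → Hⁱ(V) → Hⁱ(U) → 0`
is exact (`f₊` is onto, being the Poincaré transpose of the injective `f*`) and `F`-equivariant.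
[cite: BourbakiAlgebreVIII2012, VIII § 20 n° 6 (p. 377)] [cite: Deligne1974, (1.5.4)] -/
theorem charpoly_frobAction_eq_restrict_ker_pushforward_mul (hV : IsSmoothProjective N V)
    (hU : IsSmoothProjective N U) (f : V ⟶ U) (hf : E.pullback f (2 * N) ≠ 0) {i i' : ℕ}
    (hi : i + i' = 2 * N)
    (hst : ∀ x ∈ LinearMap.ker (E.pushforward (N := N) hU f hi hi),
      E.frobAction V i x ∈ LinearMap.ker (E.pushforward (N := N) hU f hi hi)) :
    (haveI := E.finite_obj hV i; (E.frobAction V i).charpoly) =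
      (haveI := E.finite_obj hV i; ((E.frobAction V i).restrict hst).charpoly) *
        (haveI := E.finite_obj hU i; (E.frobAction U i).charpoly) := by
  haveI := E.finite_obj hV i
  haveI := E.finite_obj hU i
  have hsurj : Function.Surjective (E.pushforward (N := N) hU f hi hi) :=
    (E.pushforward_surjective_iff hV hU f hi hi).mpr
      (E.pullback_injective_of_pullback_top_ne_zero hV hU f hf i')
  exact Literature.RepresentationTheory.Semisimple.LinearMap.charpoly_eq_mul_of_exact
    (E.frobAction V i) (LinearMap.ker _).subtype (E.pushforward (N := N) hU f hi hi)
    (LinearMap.ker _).injective_subtype hsurj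
    (Submodule.range_subtype _) ((E.frobAction V i).restrict hst) (E.frobAction U i)
    (LinearMap.ext fun x ↦ rfl) (E.frobAction_comp_pushforward_of_dim_eq hV hU f hi hi).symm

/-- **`Pᵢ(V, T) = det(1 - T F | Ker f₊) · Pᵢ(U, T)` for `f : V ⟶ U` of non-zero degree** between
varieties of the same dimension. [cite: Deligne1974, (1.5.4)] [cite: BourbakiAlgebreVIII2012, VIII § 20 n° 6 (p. 377)] -/
theorem frobCharPoly_eq_reverse_charpoly_restrict_ker_pushforward_mul (hV : IsSmoothProjective N V)
    (hU : IsSmoothProjective N U) (f : V ⟶ U) (hf : E.pullback f (2 * N) ≠ 0) {i i' : ℕ}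
    (hi : i + i' = 2 * N)
    (hst : ∀ x ∈ LinearMap.ker (E.pushforward (N := N) hU f hi hi),
      E.frobAction V i x ∈ LinearMap.ker (E.pushforward (N := N) hU f hi hi)) :
    E.frobCharPoly V i =
      (haveI := E.finite_obj hV i; ((E.frobAction V i).restrict hst).charpoly.reverse) *
        E.frobCharPoly U i := by
  rw [E.frobCharPoly_eq hV i, E.frobCharPoly_eq hU i,
    E.charpoly_frobAction_eq_restrict_ker_pushforward_mul hV hU f hf hi hst,
    Polynomial.reverse_mul_of_domain]

end Frobenius

end GaloisWeilCohomology

end Literature.AlgebraicGeometry.Motives
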